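import Mathlib.GroupTheory.Nilpotent
import Mathlib.GroupTheory.QuotientGroup.Basic
import Mathlib.GroupTheory.FreeGroup.Basic
import Mathlib.Algebra.BigOperators.Group.List.Basic
import Mathlib.Algebra.BigOperators.Fin
import Literature.Topology.FourManifolds.GroupTrisections
import Literature.Algebra.Lie.SurfaceLieAlgebra
import HarnessLib
import Summits.SmoothPoincare4.SmoothPoincare4.Theorems.CongruenceShadowsNilpotentShadowsStandardTorsorCalculus
import Summits.SmoothPoincare4.SmoothPoincare4.Theorems.CongruenceShadowsNilpotentShadowsStandardStubCutNormalForm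
import Summits.SmoothPoincare4.SmoothPoincare4.Theorems.CongruenceShadowsNilpotentShadowsStandardStubNoHiddenDepth
import Summits.SmoothPoincare4.SmoothPoincare4.Theorems.CongruenceShadowsNilpotentShadowsStandardGlueNilpotentBasis
import Summits.SmoothPoincare4.SmoothPoincare4.Theorems.CongruenceShadowsNilpotentShadowsStandardGlueCutDictionary
import Summits.SmoothPoincare4.SmoothPoincare4.Theorems.CongruenceShadowsNilpotentShadowsStandardGlueReading
import Summits.SmoothPoincare4.SmoothPoincare4.Theorems.CongruenceShadowsNilpotentShadowsStandardGlueContraction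

/-!
# Stub `stub_levelOneGlue` of line `saturated-torsor-descent` for crux
`CongruenceShadows.NilpotentShadowsStandard` (item stmt-SmoothPoincare4-14594)

**The level-one torsor argument.**  Granted (J) Johnson's theorem in generator form (every basic
3-vector of letters is the first Johnson image of an IA-automorphism of `S_g`, `g ≥ 3`) and (MW)
Magnus–Witt reading in degrees `≤ 3` for `FreeGroup (Fin n)` (`INJ2 ∧ READ`), for every `m` and
every HONEST kernel triple `K` of `S = S_{3+3m}` (normal, free single quotients of rank `3+3m`,
free pair quotients of rank `m+1`) with standard abelian shadow `Kᵢ γ₂ = Nᵢ γ₂`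
(`N = s4Kernels.stabilizeIter m`) there is an automorphism `ψ` stabilising the three `Nᵢ γ₂` and
throwing every cut letter `x ∈ Cᵢ = s4CutSystem m i` into `Kᵢ γ₃`.
Proof (`levelOne_core`): corrections `uᵢ x ∈ γ₂`, `uᵢ x · x ∈ Kᵢ`; READING of each `Kᵢ` through the
erasing projection `πᵢ : S ↠ F` of `Cᵢ` (Glue II–III: honest iso + nilpotent basis correction +
READ) gives alternating forms `Dᵢ` with `πᵢ (uᵢ x_j) ≡ PP(s_j • Dᵢ j) (mod γ₃ F)`; the `Dᵢ` agree on
common handles (pair kernels have no hidden depth, `INJ2`), so they glue to one exponent `E` on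
letter triples; `ψ = ∏_t ψ_t ^ E t` over the realisers `ψ_t` of (J); its Johnson value at a cut
letter, pushed to `F ⧸ γ₃ F`, is computed by additivity (Glue I) and the contraction identity
(Glue IV) to be `PP(s_j • Dᵢ j)`, i.e. `ψ(x) x⁻¹ ≡ uᵢ x (mod ⁅Nᵢ, S⁆ γ₃)`, which is membership
`ψ x ∈ Kᵢ γ₃` by the torsor calculus (`level_mem_iff`).  No new definitions.
-/

set_option linter.dupNamespace false

open Subgroup Literature.Topology.FourManifolds Literature.Algebra.Lie
open scoped commutatorElement

namespace Summit.SmoothPoincare4.SmoothPoincare4.Theorems.NilpotentShadowsStandard.SaturatedTorsorDescent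

section Assembly

variable {g : ℕ}

/-- An IA-automorphism stabilises every abelian shadow `A ⊔ γ₂`. [folklore] -/
theorem ia_map_sup_lcs_one {G : Type*} [Group G] {ψ : G ≃* G}
    (h : ∀ s, ψ s * s⁻¹ ∈ (⊤ : Subgroup G).lowerCentralSeries 1) (A : Subgroup G) :
    (A ⊔ (⊤ : Subgroup G).lowerCentralSeries 1).map ψ.toMonoidHom = A ⊔ (⊤ : Subgroup G).lowerCentralSeries 1 := by
  -- adapted from the lead folder work/stubs/stub_reachOne_torsor.lean
  have hle : ∀ (φ : G ≃* G), (∀ s, φ s * s⁻¹ ∈ (⊤ : Subgroup G).lowerCentralSeries 1) →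
      (A ⊔ (⊤ : Subgroup G).lowerCentralSeries 1).map φ.toMonoidHom ≤
        A ⊔ (⊤ : Subgroup G).lowerCentralSeries 1 := by
    rintro φ hφ _ ⟨y, hy, rfl⟩
    obtain ⟨a, ha, z, hz, rfl⟩ := mem_sup_of_normal_right.1 hy
    have e : φ.toMonoidHom (a * z) = (φ a * a⁻¹) * a * (φ z * z⁻¹) * z := by simp [mul_assoc]
    rw [e]
    exact mul_mem (mul_mem (mul_mem (mem_sup_right (hφ a)) (mem_sup_left ha)) (mem_sup_right (hφ z)))
      (mem_sup_right hz)
  refine le_antisymm (hle ψ h) fun y hy => ⟨ψ.symm y, hle ψ.symm (ia_symm h) ⟨y, hy, rfl⟩, by simp⟩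

/-- **Gluing the three forms.** Alternating forms `Dᵢ` on the handles that agree on the common
handles of any two cut patterns glue to one exponent `E` on letter triples, supported on increasing
handle triples and restricting on the survivor triples of pattern `i` to `Dᵢ`. [folklore] -/
theorem exists_globalForm (ct : Fin 3 → Fin g → Bool) (D : Fin 3 → Fin g → Fin g → Fin g → ℤ)
    (hcompat : ∀ i k j v w, ct i j = ct k j → ct i v = ct k v → ct i w = ct k w → D i j v w = D k j v w) :
    ∃ E : (Fin g × Bool) × (Fin g × Bool) × (Fin g × Bool) → ℤ,
      (∀ t, E t ≠ 0 → t.1.1 < t.2.1.1 ∧ t.2.1.1 < t.2.2.1) ∧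
      ∀ i h₁ h₂ h₃, E ((h₁, !ct i h₁), (h₂, !ct i h₂), (h₃, !ct i h₃)) =
        if h₁ < h₂ ∧ h₂ < h₃ then D i h₁ h₂ h₃ else 0 := by
  refine ⟨fun t => if t.1.1 < t.2.1.1 ∧ t.2.1.1 < t.2.2.1 then
      (if t.1.2 = !ct 0 t.1.1 ∧ t.2.1.2 = !ct 0 t.2.1.1 ∧ t.2.2.2 = !ct 0 t.2.2.1 then D 0 t.1.1 t.2.1.1 t.2.2.1
       else if t.1.2 = !ct 1 t.1.1 ∧ t.2.1.2 = !ct 1 t.2.1.1 ∧ t.2.2.2 = !ct 1 t.2.2.1 then D 1 t.1.1 t.2.1.1 t.2.2.1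
       else if t.1.2 = !ct 2 t.1.1 ∧ t.2.1.2 = !ct 2 t.2.1.1 ∧ t.2.2.2 = !ct 2 t.2.2.1 then D 2 t.1.1 t.2.1.1 t.2.2.1
       else 0) else 0, fun t ht => ?_, fun i h₁ h₂ h₃ => ?_⟩
  · by_contra h
    exact ht (if_neg h)
  · have key : ∀ k : Fin 3, ((!ct i h₁) = !ct k h₁ ∧ (!ct i h₂) = !ct k h₂ ∧ (!ct i h₃) = !ct k h₃) →
        D k h₁ h₂ h₃ = D i h₁ h₂ h₃ := fun k hk =>
      hcompat k i h₁ h₂ h₃ (Bool.not_inj hk.1).symm (Bool.not_inj hk.2.1).symm (Bool.not_inj hk.2.2).symm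
    simp only
    split_ifs with h hp0 hp1 hp2
    · exact key 0 hp0
    · exact key 1 hp1
    · exact key 2 hp2
    · exfalso
      fin_cases i
      · exact hp0 ⟨rfl, rfl, rfl⟩
      · exact hp1 ⟨rfl, rfl, rfl⟩
      · exact hp2 ⟨rfl, rfl, rfl⟩
    · rfl

/-- **Realisers for all letter triples** from hypothesis (J): IA-automorphisms `Ψ t` whose Johnson
value at every letter is the basic 3-vector of `t` whenever the three letters are distinct.
[folklore] -/
theorem exists_realisers
    (hJ : ∀ (g : ℕ), 3 ≤ g → ∀ (u v w : Fin g × Bool), u ≠ v → u ≠ w → v ≠ w →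
      ∃ ψ : SurfaceGroup g ≃* SurfaceGroup g,
        (∀ s : SurfaceGroup g, ψ s * s⁻¹ ∈ (⊤ : Subgroup (SurfaceGroup g)).lowerCentralSeries 1) ∧
        ∀ x : Fin g × Bool, ψ (PresentedGroup.of x : SurfaceGroup g) * (PresentedGroup.of x : SurfaceGroup g)⁻¹ *
          (⁅(PresentedGroup.of v : SurfaceGroup g), (PresentedGroup.of w : SurfaceGroup g)⁆ ^
            (if x.1 = u.1 ∧ x.2 = false ∧ u.2 = true then (1 : ℤ) else if x.1 = u.1 ∧ x.2 = true ∧ u.2 = false then (-1 : ℤ) else 0) *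
          ⁅(PresentedGroup.of w : SurfaceGroup g), (PresentedGroup.of u : SurfaceGroup g)⁆ ^
            (if x.1 = v.1 ∧ x.2 = false ∧ v.2 = true then (1 : ℤ) else if x.1 = v.1 ∧ x.2 = true ∧ v.2 = false then (-1 : ℤ) else 0) *
          ⁅(PresentedGroup.of u : SurfaceGroup g), (PresentedGroup.of v : SurfaceGroup g)⁆ ^
            (if x.1 = w.1 ∧ x.2 = false ∧ w.2 = true then (1 : ℤ) else if x.1 = w.1 ∧ x.2 = true ∧ w.2 = false then (-1 : ℤ) else 0))⁻¹ ∈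
          (⊤ : Subgroup (SurfaceGroup g)).lowerCentralSeries 2)
    (hg : 3 ≤ g) :
    ∃ Ψ : (Fin g × Bool) × (Fin g × Bool) × (Fin g × Bool) → SurfaceGroup g ≃* SurfaceGroup g,
      (∀ t, ∀ s : SurfaceGroup g, Ψ t s * s⁻¹ ∈ (⊤ : Subgroup (SurfaceGroup g)).lowerCentralSeries 1) ∧
      ∀ t, t.1 ≠ t.2.1 → t.1 ≠ t.2.2 → t.2.1 ≠ t.2.2 → ∀ x : Fin g × Bool,
        Ψ t (PresentedGroup.of x) * (PresentedGroup.of x)⁻¹ *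
          (⁅(PresentedGroup.of t.2.1 : SurfaceGroup g), PresentedGroup.of t.2.2⁆ ^
            (if x.1 = t.1.1 ∧ x.2 = false ∧ t.1.2 = true then (1 : ℤ) else if x.1 = t.1.1 ∧ x.2 = true ∧ t.1.2 = false then (-1 : ℤ) else 0) *
          ⁅(PresentedGroup.of t.2.2 : SurfaceGroup g), PresentedGroup.of t.1⁆ ^
            (if x.1 = t.2.1.1 ∧ x.2 = false ∧ t.2.1.2 = true then (1 : ℤ) else if x.1 = t.2.1.1 ∧ x.2 = true ∧ t.2.1.2 = false then (-1 : ℤ) else 0) *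
          ⁅(PresentedGroup.of t.1 : SurfaceGroup g), PresentedGroup.of t.2.1⁆ ^
            (if x.1 = t.2.2.1 ∧ x.2 = false ∧ t.2.2.2 = true then (1 : ℤ) else if x.1 = t.2.2.1 ∧ x.2 = true ∧ t.2.2.2 = false then (-1 : ℤ) else 0))⁻¹ ∈
          (⊤ : Subgroup (SurfaceGroup g)).lowerCentralSeries 2 := by
  have h : ∀ t : (Fin g × Bool) × (Fin g × Bool) × (Fin g × Bool), ∃ ψ : SurfaceGroup g ≃* SurfaceGroup g,
      (∀ s : SurfaceGroup g, ψ s * s⁻¹ ∈ (⊤ : Subgroup (SurfaceGroup g)).lowerCentralSeries 1) ∧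
      (t.1 ≠ t.2.1 → t.1 ≠ t.2.2 → t.2.1 ≠ t.2.2 → ∀ x : Fin g × Bool,
        ψ (PresentedGroup.of x) * (PresentedGroup.of x)⁻¹ *
          (⁅(PresentedGroup.of t.2.1 : SurfaceGroup g), PresentedGroup.of t.2.2⁆ ^
            (if x.1 = t.1.1 ∧ x.2 = false ∧ t.1.2 = true then (1 : ℤ) else if x.1 = t.1.1 ∧ x.2 = true ∧ t.1.2 = false then (-1 : ℤ) else 0) *
          ⁅(PresentedGroup.of t.2.2 : SurfaceGroup g), PresentedGroup.of t.1⁆ ^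
            (if x.1 = t.2.1.1 ∧ x.2 = false ∧ t.2.1.2 = true then (1 : ℤ) else if x.1 = t.2.1.1 ∧ x.2 = true ∧ t.2.1.2 = false then (-1 : ℤ) else 0) *
          ⁅(PresentedGroup.of t.1 : SurfaceGroup g), PresentedGroup.of t.2.1⁆ ^
            (if x.1 = t.2.2.1 ∧ x.2 = false ∧ t.2.2.2 = true then (1 : ℤ) else if x.1 = t.2.2.1 ∧ x.2 = true ∧ t.2.2.2 = false then (-1 : ℤ) else 0))⁻¹ ∈
          (⊤ : Subgroup (SurfaceGroup g)).lowerCentralSeries 2) := by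
    intro t
    by_cases hd : t.1 ≠ t.2.1 ∧ t.1 ≠ t.2.2 ∧ t.2.1 ≠ t.2.2
    · obtain ⟨ψ, h1, h2⟩ := hJ g hg t.1 t.2.1 t.2.2 hd.1 hd.2.1 hd.2.2
      exact ⟨ψ, h1, fun _ _ _ => h2⟩
    · exact ⟨MulEquiv.refl _, fun s => by simp [one_mem], fun h1 h2 h3 => (hd ⟨h1, h2, h3⟩).elim⟩
  choose Ψ hΨ₁ hΨ₂ using h
  exact ⟨Ψ, hΨ₁, hΨ₂⟩

/-- The Johnson value of a basic realiser at a letter, pushed to `F ⧸ γ₃ F` along a homomorphism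
`π`, as an element of the centre. [folklore] -/
theorem mk_map_triple (π : SurfaceGroup g →* FreeGroup (Fin g))
    (cz : Fin g × Bool → Fin g × Bool → center (FreeGroup (Fin g) ⧸ (⊤ : Subgroup (FreeGroup (Fin g))).lowerCentralSeries 2))
    (hcz : ∀ p q, (cz p q : FreeGroup (Fin g) ⧸ (⊤ : Subgroup (FreeGroup (Fin g))).lowerCentralSeries 2) =
      ⁅(π (PresentedGroup.of p) : FreeGroup (Fin g) ⧸ (⊤ : Subgroup (FreeGroup (Fin g))).lowerCentralSeries 2),
        (π (PresentedGroup.of q) : FreeGroup (Fin g) ⧸ _)⁆)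
    (p q r : Fin g × Bool) (a b c : ℤ) :
    ((π (⁅(PresentedGroup.of q : SurfaceGroup g), PresentedGroup.of r⁆ ^ a *
        ⁅(PresentedGroup.of r : SurfaceGroup g), PresentedGroup.of p⁆ ^ b *
        ⁅(PresentedGroup.of p : SurfaceGroup g), PresentedGroup.of q⁆ ^ c) : FreeGroup (Fin g)) :
          FreeGroup (Fin g) ⧸ (⊤ : Subgroup (FreeGroup (Fin g))).lowerCentralSeries 2) =
      ((cz q r ^ a * cz r p ^ b * cz p q ^ c :
        center (FreeGroup (Fin g) ⧸ (⊤ : Subgroup (FreeGroup (Fin g))).lowerCentralSeries 2)) :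
          FreeGroup (Fin g) ⧸ (⊤ : Subgroup (FreeGroup (Fin g))).lowerCentralSeries 2) := by
  simp only [map_mul, map_zpow, map_commutatorElement, Subgroup.coe_mul, Subgroup.coe_zpow, hcz,
    ← QuotientGroup.mk'_apply]

end Assembly

/-! ## The core theorem -/

section Core

open scoped IsMulCommutative

/-- **The level-one step in torsor coordinates** (see the module docstring), with the cut normal
form and the no-hidden-depth lemma as explicit hypotheses (the landed `stub_cutNormalForm`,
`stub_noHiddenDepth`). [folklore] -/
theorem levelOne_core
    (hJ : ∀ (g : ℕ), 3 ≤ g → ∀ (u v w : Fin g × Bool), u ≠ v → u ≠ w → v ≠ w →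
      ∃ ψ : SurfaceGroup g ≃* SurfaceGroup g,
        (∀ s : SurfaceGroup g, ψ s * s⁻¹ ∈ (⊤ : Subgroup (SurfaceGroup g)).lowerCentralSeries 1) ∧
        ∀ x : Fin g × Bool, ψ (PresentedGroup.of x : SurfaceGroup g) * (PresentedGroup.of x : SurfaceGroup g)⁻¹ *
          (⁅(PresentedGroup.of v : SurfaceGroup g), (PresentedGroup.of w : SurfaceGroup g)⁆ ^
            (if x.1 = u.1 ∧ x.2 = false ∧ u.2 = true then (1 : ℤ) else if x.1 = u.1 ∧ x.2 = true ∧ u.2 = false then (-1 : ℤ) else 0) *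
          ⁅(PresentedGroup.of w : SurfaceGroup g), (PresentedGroup.of u : SurfaceGroup g)⁆ ^
            (if x.1 = v.1 ∧ x.2 = false ∧ v.2 = true then (1 : ℤ) else if x.1 = v.1 ∧ x.2 = true ∧ v.2 = false then (-1 : ℤ) else 0) *
          ⁅(PresentedGroup.of u : SurfaceGroup g), (PresentedGroup.of v : SurfaceGroup g)⁆ ^
            (if x.1 = w.1 ∧ x.2 = false ∧ w.2 = true then (1 : ℤ) else if x.1 = w.1 ∧ x.2 = true ∧ w.2 = false then (-1 : ℤ) else 0))⁻¹ ∈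
          (⊤ : Subgroup (SurfaceGroup g)).lowerCentralSeries 2)
    (hINJ : ∀ (n : ℕ) (e : Fin n → Fin n → ℤ), ((List.finRange n).map (fun v => ((List.finRange n).map
      (fun w => if v < w then ⁅(FreeGroup.of v : FreeGroup (Fin n)), FreeGroup.of w⁆ ^ (e v w)
        else (1 : FreeGroup (Fin n)))).prod)).prod ∈ (⊤ : Subgroup (FreeGroup (Fin n))).lowerCentralSeries 2 →
      ∀ v w : Fin n, v < w → e v w = 0)
    (hREAD : ∀ (n : ℕ) (s : Fin n → ℤ) (η : Fin n → FreeGroup (Fin n)), (∀ j, s j = 1 ∨ s j = -1) →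
      (∀ j, η j ∈ (⊤ : Subgroup (FreeGroup (Fin n))).lowerCentralSeries 1) →
      ((List.finRange n).map (fun j => ⁅(η j)⁻¹, FreeGroup.of j⁆ ^ (s j))).prod ∈
        (⊤ : Subgroup (FreeGroup (Fin n))).lowerCentralSeries 3 →
      ∃ D : Fin n → Fin n → Fin n → ℤ, (∀ a b c, D b a c = -D a b c) ∧ (∀ a b c, D a c b = -D a b c) ∧
        ∀ j, η j * (((List.finRange n).map (fun v => ((List.finRange n).map (fun w =>
          if v < w then ⁅(FreeGroup.of v : FreeGroup (Fin n)), FreeGroup.of w⁆ ^ (s j * D j v w)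
          else (1 : FreeGroup (Fin n)))).prod)).prod)⁻¹ ∈
          (⊤ : Subgroup (FreeGroup (Fin n))).lowerCentralSeries 2)
    (hcut : ∀ (m : ℕ) (i : Fin 3), s4Kernels.stabilizeIter m i =
      normalClosure (PresentedGroup.of '' s4CutSystem m i))
    (hnhd : ∀ (g n : ℕ) (Q : Subgroup (SurfaceGroup g)) [Q.Normal], IsFreeOfRank (SurfaceGroup g ⧸ Q) n →
      Q ⊓ (⊤ : Subgroup (SurfaceGroup g)).lowerCentralSeries 1 ≤ ⁅Q, (⊤ : Subgroup (SurfaceGroup g))⁆)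
    (m : ℕ) (K : TrisectionKernels (3 + 3 * m)) (hn : ∀ i, (K i).Normal)
    (hfree : ∀ i, IsFreeOfRank (SurfaceGroup (3 + 3 * m) ⧸ normalClosure (K i : Set (SurfaceGroup (3 + 3 * m)))) (3 + 3 * m))
    (hpair : ∀ i j : Fin 3, i ≠ j → IsFreeOfRank (K.pairQuotient i j) (m + 1))
    (hnose : ∀ i, K i ⊔ (⊤ : Subgroup (SurfaceGroup (3 + 3 * m))).lowerCentralSeries 1 =
      s4Kernels.stabilizeIter m i ⊔ (⊤ : Subgroup (SurfaceGroup (3 + 3 * m))).lowerCentralSeries 1) :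
    ∃ ψ : SurfaceGroup (3 + 3 * m) ≃* SurfaceGroup (3 + 3 * m),
      (∀ i : Fin 3, (s4Kernels.stabilizeIter m i ⊔ (⊤ : Subgroup (SurfaceGroup (3 + 3 * m))).lowerCentralSeries 1).map
        ψ.toMonoidHom = s4Kernels.stabilizeIter m i ⊔ (⊤ : Subgroup (SurfaceGroup (3 + 3 * m))).lowerCentralSeries 1) ∧
      ∀ i : Fin 3, ∀ x ∈ s4CutSystem m i, ψ (PresentedGroup.of x) ∈
        K i ⊔ (⊤ : Subgroup (SurfaceGroup (3 + 3 * m))).lowerCentralSeries 2 := by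
  -- (0) the cut dictionary
  choose ct π hct hπs hπker hπof using fun i => helper_glueErasePi m i (hcut m i)
  have hNn : ∀ i, (s4Kernels.stabilizeIter m i).Normal := fun i => by rw [← hπker i]; infer_instance
  have hKle : ∀ i, K i ≤ (π i).ker ⊔ (⊤ : Subgroup (SurfaceGroup (3 + 3 * m))).lowerCentralSeries 1 :=
    fun i => by rw [hπker i, ← hnose i]; exact le_sup_left
  have hKfree : ∀ i, IsFreeOfRank (SurfaceGroup (3 + 3 * m) ⧸ K i) (3 + 3 * m) := fun i =>
    (hfree i).of_mulEquiv (QuotientGroup.quotientMulEquivOfEq (normalClosure_eq_self (K i)))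
  have hKnhd : ∀ i, K i ⊓ (⊤ : Subgroup (SurfaceGroup (3 + 3 * m))).lowerCentralSeries 1 ≤
      ⁅K i, (⊤ : Subgroup (SurfaceGroup (3 + 3 * m)))⁆ := fun i => hnhd _ _ (K i) (hKfree i)
  have hπnhd : ∀ i, (π i).ker ⊓ (⊤ : Subgroup (SurfaceGroup (3 + 3 * m))).lowerCentralSeries 1 ≤
      ⁅(π i).ker, (⊤ : Subgroup (SurfaceGroup (3 + 3 * m)))⁆ :=
    fun i => hnhd _ _ (π i).ker (isFreeOfRank_quotient_ker (π i) (hπs i))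
  -- (1) corrections
  have hcorr : ∀ (i : Fin 3) (h : Fin (3 + 3 * m)), ∃ v : SurfaceGroup (3 + 3 * m),
      v ∈ (⊤ : Subgroup (SurfaceGroup (3 + 3 * m))).lowerCentralSeries 1 ∧
      v * PresentedGroup.of (h, ct i h) ∈ K i := by
    intro i h
    have hx : (PresentedGroup.of (h, ct i h) : SurfaceGroup (3 + 3 * m)) ∈
        K i ⊔ (⊤ : Subgroup (SurfaceGroup (3 + 3 * m))).lowerCentralSeries 1 := by
      rw [hnose i, ← hπker i]
      refine mem_sup_left ?_
      rw [MonoidHom.mem_ker, hπof, if_pos rfl]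
    rw [sup_comm] at hx
    obtain ⟨z, hz, k, hk, e⟩ := mem_sup_of_normal_left.1 hx
    refine ⟨z⁻¹, inv_mem hz, ?_⟩
    rw [← e, inv_mul_cancel_left]
    exact hk
  choose u hu₁ hu₂ using hcorr
  -- (2) honest comparison maps and the readings
  have hρ : ∀ i : Fin 3, ∃ ρ : SurfaceGroup (3 + 3 * m) →* FreeGroup (Fin (3 + 3 * m)),
      Function.Surjective ρ ∧ ρ.ker = K i := fun i => by
    obtain ⟨α⟩ := hfree i
    refine ⟨α.symm.toMonoidHom.comp (QuotientGroup.mk' _), α.symm.surjective.comp (QuotientGroup.mk'_surjective _), ?_⟩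
    rw [MulEquiv.toMonoidHom_eq_coe, MonoidHom.ker_mulEquiv_comp, QuotientGroup.ker_mk', normalClosure_eq_self]
  choose ρ hρs hρker using hρ
  choose D hD1 hD2 hD using fun i => reading hREAD (ct i) (π i) (hπof i) (K i) (ρ i) (hρs i) (hρker i)
    (hKle i) (u i) (hu₁ i) (hu₂ i)
  -- (3) compatibility on common handles
  have hcompat : ∀ (i k : Fin 3) (j v w : Fin (3 + 3 * m)), ct i j = ct k j → ct i v = ct k v → ct i w = ct k w →
      D i j v w = D k j v w := by
    intro i k j v w hj hv hw
    by_cases hik : i = k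
    · subst hik; rfl
    haveI : (K i ⊔ K k).Normal := inferInstance
    have hQfree : IsFreeOfRank (SurfaceGroup (3 + 3 * m) ⧸ (K i ⊔ K k)) (m + 1) :=
      (hpair i k hik).of_mulEquiv (QuotientGroup.quotientMulEquivOfEq (normalClosure_union_eq_sup (K i) (K k)))
    have hQnhd := hnhd _ _ (K i ⊔ K k) hQfree
    have hQle : K i ⊔ K k ≤ ((π i).ker ⊔ (π k).ker) ⊔ (⊤ : Subgroup (SurfaceGroup (3 + 3 * m))).lowerCentralSeries 1 :=
      sup_le ((hKle i).trans (sup_le_sup_right le_sup_left _)) ((hKle k).trans (sup_le_sup_right le_sup_right _))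
    exact reading_compat hINJ (ct i) (ct k) (π i) (π k) (hπof i) (hπof k) (K i ⊔ K k) hQnhd hQle (u i) (u k)
      (hu₁ i) (hu₁ k) (fun h => mem_sup_left (hu₂ i h)) (fun h => mem_sup_right (hu₂ k h)) (D i) (D k)
      (hD2 i) (hD2 k) (hD i) (hD k) j v w hj hv hw
  -- (4) the global exponent and the realisers
  obtain ⟨E, hEsupp, hE⟩ := exists_globalForm ct D hcompat
  obtain ⟨Ψ, hΨ₁, hΨ₂⟩ := exists_realisers hJ (Nat.le_add_right 3 (3 * m))
  classical
  set l := (Finset.univ : Finset ((Fin (3 + 3 * m) × Bool) × (Fin (3 + 3 * m) × Bool) × (Fin (3 + 3 * m) × Bool))).toList with hl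
  obtain ⟨hψ₁, hψ₂⟩ := ia_list_prod_zpow l Ψ E hΨ₁
  set ψ := (l.map fun t => ((Ψ t : MulAut (SurfaceGroup (3 + 3 * m))) ^ E t : MulAut (SurfaceGroup (3 + 3 * m)))).prod with hψ
  refine ⟨ψ, fun i => ia_map_sup_lcs_one hψ₁ _, fun i x hx => ?_⟩
  -- (5) verification at the cut letter `x = (j, ct i j)`
  obtain ⟨j, b⟩ := x
  obtain rfl : b = ct i j := (hct i j b).1 hx
  haveI := hn i
  refine (level_mem_iff 0 (K i) (s4Kernels.stabilizeIter m i) (hKnhd i) (hnose i) (hu₂ i j) (hψ₁ _) (hu₁ i j)).2 ?_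
  rw [← hπker i]
  refine mem_commutator_sup_of_map_mem (π i) (hπs i) (hπnhd i) (mul_mem (hψ₁ _) (inv_mem (hu₁ i j))) ?_
  -- push the Johnson value to `F ⧸ γ₃ F`
  set F := FreeGroup (Fin (3 + 3 * m)) with hF
  set Γ₃ := (⊤ : Subgroup (FreeGroup (Fin (3 + 3 * m)))).lowerCentralSeries 2 with hΓ₃
  rw [map_mul, map_inv, mul_inv_mem_iff_quot, (mul_inv_mem_iff_quot _ _ _).1 (hD i j)]
  have hle : (⊤ : Subgroup (SurfaceGroup (3 + 3 * m))).lowerCentralSeries 2 ≤ Γ₃.comap (π i) :=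
    fun s hs => map_lcs_mem (π i) hs
  set πbar := QuotientGroup.map _ Γ₃ (π i) hle with hπbar
  have hπbar : ∀ s : SurfaceGroup (3 + 3 * m), (π i s : F ⧸ Γ₃) = πbar (s : SurfaceGroup (3 + 3 * m) ⧸
      (⊤ : Subgroup (SurfaceGroup (3 + 3 * m))).lowerCentralSeries 2) := fun s => rfl
  rw [hπbar, hψ₂, map_list_prod, List.map_map]
  -- the letter pairing in the centre of `F ⧸ γ₃ F`
  set cz : Fin (3 + 3 * m) × Bool → Fin (3 + 3 * m) × Bool → center (F ⧸ Γ₃) := fun p q =>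
    ⟨⁅(π i (PresentedGroup.of p) : F ⧸ Γ₃), (π i (PresentedGroup.of q) : F ⧸ Γ₃)⁆, quot_commutator_mem_center _ _⟩
    with hcz
  set cc : Fin (3 + 3 * m) → Fin (3 + 3 * m) → center (F ⧸ Γ₃) := fun v w =>
    ⟨⁅((FreeGroup.of v : F) : F ⧸ Γ₃), ((FreeGroup.of w : F) : F ⧸ Γ₃)⁆, quot_commutator_mem_center _ _⟩ with hcc
  set PZ : Fin (3 + 3 * m) × Bool → ℤ := fun p =>
    if j = p.1 ∧ ct i j = false ∧ p.2 = true then 1 else if j = p.1 ∧ ct i j = true ∧ p.2 = false then -1 else 0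
    with hPZ
  have hterm : ∀ t, (πbar ∘ fun t => (((Ψ t (PresentedGroup.of (j, ct i j)) * (PresentedGroup.of (j, ct i j))⁻¹ :
      SurfaceGroup (3 + 3 * m)) : SurfaceGroup (3 + 3 * m) ⧸ (⊤ : Subgroup (SurfaceGroup (3 + 3 * m))).lowerCentralSeries 2)
        ^ E t)) t =
      ((cz t.2.1 t.2.2 ^ PZ t.1 * cz t.2.2 t.1 ^ PZ t.2.1 * cz t.1 t.2.1 ^ PZ t.2.2 : center (F ⧸ Γ₃)) : F ⧸ Γ₃) ^ E t := by
    intro t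
    rw [Function.comp_apply, map_zpow]
    by_cases hEt : E t = 0
    · rw [hEt, zpow_zero, zpow_zero]
    obtain ⟨h12, h23⟩ := hEsupp t hEt
    have hspec := hΨ₂ t (fun h => (h ▸ h12).false) (fun h => (h ▸ (h12.trans h23)).false)
      (fun h => (h ▸ h23).false) (j, ct i j)
    rw [mul_inv_mem_iff_quot] at hspec
    rw [hspec, ← hπbar, mk_map_triple (π i) cz (fun p q => rfl)]
  rw [List.map_congr_left fun t _ => hterm t, coe_list_prod_zpow, prod_map_toList,
    verification_identity cc (fun v w => ?_) (ct i) j PZ (fun p => rfl) cz (fun p q hpq => ?_) (fun v w => ?_)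
      (D i) (hD1 i) (hD2 i) E (hE i), ← pp_eq_coe_prod, ← QuotientGroup.mk'_apply, pp_map]
  · exact pp_congr _ _ _ _ fun v w _ => by rw [map_commutatorElement]; rfl
  · -- antisymmetry of `cc`
    exact Subtype.ext (commutatorElement_inv _ _).symm
  · -- `cz` kills cut letters
    refine Subtype.ext ?_
    rcases hpq with hp | hq
    · simp only [hcz, hπof, hp, if_true, QuotientGroup.mk_one, commutatorElement_one_left, Subgroup.coe_one]
    · simp only [hcz, hπof, hq, if_true, QuotientGroup.mk_one, commutatorElement_one_right, Subgroup.coe_one]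
  · -- `cz` on survivors
    refine Subtype.ext ?_
    have hv : (!ct i v) ≠ ct i v := by cases ct i v <;> decide
    have hw : (!ct i w) ≠ ct i w := by cases ct i w <;> decide
    simp only [hcz, hcc, hπof, if_neg hv, if_neg hw]

end Core

/-- **Registered stub `stub_levelOneGlue`** (line `saturated-torsor-descent`): the level-one torsor
argument — (J) Johnson's theorem in generator form and (MW) Magnus–Witt reading in degrees `≤ 3`
imply the level-one step of the descent for every `m`. [folklore] -/
theorem stub_levelOneGlue : (∀ (g : ℕ), 3 ≤ g → ∀ (u v w : Fin g × Bool), u ≠ v → u ≠ w → v ≠ w → ∃ ψ : Literature.Topology.FourManifolds.SurfaceGroup g ≃* Literature.Topology.FourManifolds.SurfaceGroup g, (∀ s : Literature.Topology.FourManifolds.SurfaceGroup g, ψ s * s⁻¹ ∈ (⊤ : Subgroup (Literature.Topology.FourManifolds.SurfaceGroup g)).lowerCentralSeries 1) ∧ ∀ x : Fin g × Bool, ψ (PresentedGroup.of x : Literature.Topology.FourManifolds.SurfaceGroup g) * (PresentedGroup.of x : Literature.Topology.FourManifolds.SurfaceGroup g)⁻¹ * (⁅(PresentedGroup.of v : Literature.Topology.FourManifolds.SurfaceGroup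 g), (PresentedGroup.of w : Literature.Topology.FourManifolds.SurfaceGroup g)⁆ ^ (if x.1 = u.1 ∧ x.2 = false ∧ u.2 = true then (1 : ℤ) else if x.1 = u.1 ∧ x.2 = true ∧ u.2 = false then (-1 : ℤ) else 0) * ⁅(PresentedGroup.of w : Literature.Topology.FourManifolds.SurfaceGroup g), (PresentedGroup.of u : Literature.Topology.FourManifolds.SurfaceGroup g)⁆ ^ (if x.1 = v.1 ∧ x.2 = false ∧ v.2 = true then (1 : ℤ) else if x.1 = v.1 ∧ x.2 = true ∧ v.2 = false then (-1 : ℤ) else 0) * ⁅(PresentedGroup.of u : Literature.Topology.FourManifolds.SurfaceGroup g), (PresentedGroup.of v : Literature.Topology.FourManifolds.SurfaceGroup g)⁆ ^ (if x.1 = w.1 ∧ x.2 = false ∧ w.2 = true then (1 : ℤ) else if x.1 = w.1 ∧ x.2 = true ∧ w.2 = false then (-1 : ℤ) else 0))⁻¹ ∈ (⊤ : Subgroup (Literature.Topology.FourManifolds.SurfaceGroup g)).lowerCentralSeries 2) → ((∀ (n : ℕ) (e : Fin n → Fin n → ℤ), ((List.finRange n).map (fun v => ((List.finRange n).map (fun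 w => if v < w then ⁅(FreeGroup.of v : FreeGroup (Fin n)), FreeGroup.of w⁆ ^ (e v w) else (1 : FreeGroup (Fin n)))).prod)).prod ∈ (⊤ : Subgroup (FreeGroup (Fin n))).lowerCentralSeries 2 → ∀ v w : Fin n, v < w → e v w = 0) ∧ (∀ (n : ℕ) (s : Fin n → ℤ) (η : Fin n → FreeGroup (Fin n)), (∀ j, s j = 1 ∨ s j = -1) → (∀ j, η j ∈ (⊤ : Subgroup (FreeGroup (Fin n))).lowerCentralSeries 1) → ((List.finRange n).map (fun j => ⁅(η j)⁻¹, FreeGroup.of j⁆ ^ (s j))).prod ∈ (⊤ : Subgroup (FreeGroup (Fin n))).lowerCentralSeries 3 → ∃ D : Fin n → Fin n → Fin n → ℤ, (∀ a b c, D b a c = -D a b c) ∧ (∀ a b c, D a c b = -D a b c) ∧ ∀ j, η j * (((List.finRange n).map (fun v => ((List.finRange n).map (fun w => if v < w then ⁅(FreeGroup.of v : FreeGroup (Fin n)), FreeGroup.of w⁆ ^ (s j * D j v w) else (1 : FreeGroup (Fin n)))).prod)).prod)⁻¹ ∈ (⊤ : Subgroup (FreeGroup (Fin n))).lowerCentralSeries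 2)) → ∀ (m : ℕ) (K : Literature.Topology.FourManifolds.TrisectionKernels (3 + 3 * m)), (∀ i, (K i).Normal) → (∀ i, Literature.Topology.FourManifolds.IsFreeOfRank (Literature.Topology.FourManifolds.SurfaceGroup (3 + 3 * m) ⧸ Subgroup.normalClosure (K i : Set (Literature.Topology.FourManifolds.SurfaceGroup (3 + 3 * m)))) (3 + 3 * m)) → (∀ i j : Fin 3, i ≠ j → Literature.Topology.FourManifolds.IsFreeOfRank (K.pairQuotient i j) (m + 1)) → (∀ i, K i ⊔ (⊤ : Subgroup (Literature.Topology.FourManifolds.SurfaceGroup (3 + 3 * m))).lowerCentralSeries 1 = Literature.Topology.FourManifolds.s4Kernels.stabilizeIter m i ⊔ (⊤ : Subgroup (Literature.Topology.FourManifolds.SurfaceGroup (3 + 3 * m))).lowerCentralSeries 1) → ∃ ψ : Literature.Topology.FourManifolds.SurfaceGroup (3 + 3 * m) ≃* Literature.Topology.FourManifolds.SurfaceGroup (3 + 3 * m), (∀ i : Fin 3, (Literature.Topology.FourManifolds.s4Kernels.stabilizeIter m i ⊔ (⊤ : Subgroup (Literature.Topology.FourManifolds.SurfaceGroup (3 +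 3 * m))).lowerCentralSeries 1).map ψ.toMonoidHom = Literature.Topology.FourManifolds.s4Kernels.stabilizeIter m i ⊔ (⊤ : Subgroup (Literature.Topology.FourManifolds.SurfaceGroup (3 + 3 * m))).lowerCentralSeries 1) ∧ ∀ i : Fin 3, ∀ x ∈ Literature.Algebra.Lie.s4CutSystem m i, ψ (PresentedGroup.of x) ∈ K i ⊔ (⊤ : Subgroup (Literature.Topology.FourManifolds.SurfaceGroup (3 + 3 * m))).lowerCentralSeries 2 :=
  fun hJ hMW m K hn hfree hpair hnose =>
    levelOne_core hJ hMW.1 hMW.2 stub_cutNormalForm (fun g n Q _ h => stub_noHiddenDepth g n Q h) m K hn hfree hpair hnose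

end Summit.SmoothPoincare4.SmoothPoincare4.Theorems.NilpotentShadowsStandard.SaturatedTorsorDescent
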